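import Literature.MathematicalPhysics.QuantumFieldTheory.Balaban1983to89.B9Eq321LandauProjectionZd

/-!
# `Balaban1983to89.B9Eq326GaugeTermSquareZd` — [Balaban1985BackgroundPropagators] (3.20) p. 394 ∕ (3.26) p. 395 at the `ℤᵈ × 𝔸` carriers: THE GAUGE-FIXING
# TERM `D^η_U R(U) D^{η*}_U` OF `Δ^η_a(U)` IS A SQUARE — for the CONSTRUCTED projection `R(U₀)` of `B9Eq321LandauProjectionZd` and the genuine letter
# `DRDs := D^η_{U₀} R(U₀) 𝟙_{Ω₀}D^{η*}_{U₀}`: `⟨A, D R D* A⟩ = ‖R(U₀)(𝟙_{Ω₀}D^{η*}_{U₀}A)‖² ≥ 0` at every unitary background (the exponent «−(1/2α)‖RD*A‖²» of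
# (3.20); the torus statement is `B9Thm311ProjectionR` for def-Y's letters), `= 0` iff the Landau condition holds in projection form

statement-level skeleton of published theorems with citation tags; proofs where landed; nothing here is a claim about the
Yang–Mills mass gap

`[Balaban1985BackgroundPropagators]` ("B9", CMP **99** (1985) 389–434) pp. 393–394 (3.17)–(3.20) (the gauge-fixing density and its Gaussian integral: the
exponent `−(1/2α)⟨D^{η*}A, R D^{η*}A⟩`), p. 395 (3.26) *«Δ^η_a(U) = Δ^η(U) + D^η_U R(U) D^{η*}_U + Q*(U)aQ(U)»*, Thm 3.11 p. 416 (positivity of `Δ_a`);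
`[Balaban1985RegularSpaces]` (1.1) p. 76 (the two covariant derivatives, adjoint to each other).

CITATION HEADER (lean-in-tree rule).  Cell `pub-ymgap`, DAG node N06 = [B9], width seat `pub-ymgap-dag-n06-w4` (g0), W-SEAT-START-LIST § n06 ITEM 4.  WHY: with `R(U₀)`
an OBJECT (`B9Eq321LandauProjectionZd.projE ∕ projR`, an ORTHOGONAL projection for the pairing `Re τ(a*b)` at a unitary background), the second summand of
(3.26) for the genuine letter is `⟨A, D^η_{U₀}R(U₀)D^{η*}_{U₀}A⟩ = ⟨D^{η*}_{U₀}A, R D^{η*}_{U₀}A⟩ = ⟨R D^{η*}A, R D^{η*}A⟩` — the first step is the adjointness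
of `D^η` and `D^{η*}` for the `Ad`-invariant pairing (`B9Eq321LandauOrthogonalZd.finsum_pair_covDerivFwd`, unitary `U₀`), the second `R = R² = Rᵀ`
(`projE_isIdempotentElem`, `formE_projE_symm`).  This is the `ℤᵈ`-carrier twin of `B9Thm311ProjectionR`'s «the gauge-fixing term is a SQUARE» for
def-Y's torus letters, and the positivity input the junction binder `InvAt` ([B9] Thm 3.11 regime) will need from the `DRD*` slot.

WHAT IS PROVED (kernel, 0 sorry; theorems only).  §1 `re_trace_star_pair_invariant` (the pairing `Re τ(a*b)` is `Ad`-invariant under UNITARY units for a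
tracial `τ`); `finsum_re_trace_bond_covDerivFwd` (`Σ_μ Σᶠ_x Re τ(A(x,μ)* (D^η_{U₀,μ}g)(x)) = Σᶠ_x Re τ((D^{η*}_{U₀}A)(x)* g(x))` — `D^{η*}` is the adjoint of `D^η`
on bond fields, unitary `U₀`, finitely supported `A`); §2 ★★ `finsum_re_trace_bond_DRD_eq_formE_sq` (`⟨A, D R(U₀) 𝟙_{Ω₀}D* A⟩ = formE (R f) (R f)`,
`f = 𝟙_{Ω₀}D^{η*}_{U₀}A`); ★★ `finsum_re_trace_bond_DRD_nonneg` (`≥ 0`); ★ `finsum_re_trace_bond_DRD_eq_zero_iff` (`= 0 ↔ R(U₀)(𝟙_{Ω₀}D^{η*}_{U₀}A) = 0`); `formE_projE_self_le` (Bessel, `‖R‖ ≤ 1`), ★ `finsum_re_trace_bond_DRD_le_div_sq`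
(`⟨A, D R D* A⟩ ≤ ‖𝟙_{Ω₀}D^{η*}_{U₀}A‖²`); ★ `formE_sub_projE_self_le` ((3.22) verbatim for the constructed `R`: `Rf` minimises `‖f − w‖²` over the range);
§3 `opsLandau_DRDs_form_nonneg` (the same for the letter family `opsLandau τ ops₀` at a member with finite `Ω₀`); §4 (the PRINCIPAL PART) `support_plaqCovDeriv_finite`,
★★ `sum_finsum_pair_Jcur` (THE ENERGY IDENTITY at a curved background for every Ad-invariant pairing: `Σ_κ Σᶠ B(A_κ, J_κ) = Σ_{ν<κ} Σᶠ B((D^η_{U₀}A)_{νκ},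
(D^η_{U₀}A)_{νκ})`, `J = D^{η*}_{U₀}D^η_{U₀}A` = `B8Eq155JBound.Jcur` — the curved twin of dag-n05-w3's flat `B8FlatBondCalculusZd.sum_finsum_conj_mul_Jcur`),
★★ `sum_finsum_re_trace_Jcur_nonneg` (`⟨A, D*DA⟩ ≥ 0` for `Re τ(a*b)` at a unitary background); §5 `covDivB_gaugeMode`, ★★ `gaugeMode_DRD_form_eq_laplacian_energy`
(on a gauge mode `A = D^η_{U₀}λ`, `λ ∈ N_𝔤(Q′(U₀))`: `⟨A, D R(U₀) D* A⟩ = ‖Δ^η_{U₀}λ‖²_{L²(Ω₀)}` — the `DRD*` summand is the full Laplacian energy on the pure-gauge directions).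

HONEST SCOPE.  (i) Quadratic-form bookkeeping for TWO summands of (3.26) — the gauge-fixing term with the constructed `R(U₀)` and the principal part `D*D`;
the curvature part `Δ′` (small, not signed — (3.69)), `Q*aQ` and the POSITIVITY of `Δ^η_a(U)` (Thm 3.11) are NOT touched.  (ii) `τ` a parameter (tracial ∕ Hermitian ∕ faithful), `U₀` unitary, `A` finitely
supported (the member's `E(Ω₀)` fields on a finite `Ω₀` are).  (iii) Count-neutral; N05 ∕ N06 NOT discharged; one finite `𝕋⁴` programme at fixed `ε`, Bałaban
as printed; R4 closes only the conditional finite-`𝕋⁴` rung `BalabanLadder.UV` — nothing continuum ∕ ℝ⁴ ∕ OS ∕ mass gap ∕ Clay.  Unit `pub-ymgap-dag-n06-w4` (g0), 2026-08-28.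
-/

noncomputable section

namespace Literature.MathematicalPhysics.QuantumFieldTheory.Balaban1983to89.B9Eq326GaugeTermSquareZd

open B7Prop1Explicit B7Eq78Linearization
open B7Prop2Explicit (unitaryUnits)
open B8Ineq132 (covDeriv covDerivFwd)
open B8Eq138LandauZd (covDivB covLap)
open B8LeafModelZd (ZdIdx)
open B9SupplySockB9P3ZdLetters (OpsZd)
open B9Eq321LandauOrthogonalZd (finsum_pair_covDerivFwd trace_mul_conjR)
open B9Eq321LandauProjectionZd (suppSub formE projE projR opsLandau indicator_mem_suppSub formE_apply projE_apply_mem_range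
  projE_isIdempotentElem formE_projE_symm formE_apply_self_eq_zero star_conjR_of_mem_unitaryUnits)

-- `Site` alone could resolve to the torus sites of `Setup.lean`; re-export the `ℤ^d` sites of `B7Prop1Explicit`.
export B7Prop1Explicit (Site)

variable {d : ℕ} {𝔸 : Type*} [CStarAlgebra 𝔸]

/-! ## §1  The pairing `Re τ(a* b)` and the adjointness `D^{η*} = (D^η)ᵀ` on bond fields -/

section Pairing

variable (τ : 𝔸 →ₗ[ℂ] ℂ)

/-- **`Re τ(a*b)` IS `Ad`-INVARIANT UNDER UNITARY UNITS** for a tracial `τ`: `Re τ((R(u)a)* b) = Re τ(a* R(u⁻¹)b)` (`(uau⁻¹)* = ua*u⁻¹` for unitary `u`, then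
cyclicity). [cite: Balaban1985BackgroundPropagators, p.391 («X·Y = tr XY»), (3.28) p.395] -/
theorem re_trace_star_pair_invariant (hτt : ∀ a b : 𝔸, τ (a * b) = τ (b * a)) {u : 𝔸ˣ} (hu : u ∈ unitaryUnits 𝔸) (a b : 𝔸) :
    (τ (star (conjR u a) * b)).re = (τ (star a * conjR u⁻¹ b)).re := by
  rw [star_conjR_of_mem_unitaryUnits hu, trace_mul_conjR τ hτt u (star a) b]

variable (η : ℝ) {U₀ : Site d → Fin d → 𝔸ˣ}

/-- **`D^{η*}_{U₀}` IS THE ADJOINT OF `D^η_{U₀}` ON BOND FIELDS** for the pairing `Re τ(a*b)` at a UNITARY background: for a finitely supported bond field `A`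
and any site function `g`, `Σ_μ Σᶠ_x Re τ(A(x,μ)* (D^η_{U₀,μ}g)(x)) = Σᶠ_x Re τ((D^{η*}_{U₀}A)(x)* g(x))` (the companion file's `finsum_pair_covDerivFwd`
summed over the directions). [cite: Balaban1985RegularSpaces, (1.1) p.76; Balaban1985BackgroundPropagators, (3.23) p.394, p.391 (the adjoints)] -/
theorem finsum_re_trace_bond_covDerivFwd (hτt : ∀ a b : 𝔸, τ (a * b) = τ (b * a))
    (hU : ∀ (x : Site d) (κ : Fin d), U₀ x κ ∈ unitaryUnits 𝔸) {A : Site d → Fin d → 𝔸}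
    (hA : ∀ μ : Fin d, (Function.support fun x => A x μ).Finite) (g : Site d → 𝔸) :
    ∑ μ : Fin d, ∑ᶠ x, (τ (star (A x μ) * covDerivFwd η U₀ μ g x)).re = ∑ᶠ x, (τ (star (covDivB η U₀ A x) * g x)).re := by
  -- the real pairing `Re τ(a* b)` as a bilinear map
  let B : 𝔸 →ₗ[ℝ] 𝔸 →ₗ[ℝ] ℝ :=
    LinearMap.mk₂ ℝ (fun a b => (τ (star a * b)).re)
      (fun a₁ a₂ b => by rw [star_add, add_mul, map_add, Complex.add_re])
      (fun c a b => by
        rw [star_smul, star_trivial, smul_mul_assoc, ← Complex.coe_smul, map_smul, smul_eq_mul, smul_eq_mul, Complex.re_ofReal_mul])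
      (fun a b₁ b₂ => by rw [mul_add, map_add, Complex.add_re])
      (fun c a b => by rw [mul_smul_comm, ← Complex.coe_smul, map_smul, smul_eq_mul, smul_eq_mul, Complex.re_ofReal_mul])
  have hB : ∀ u ∈ unitaryUnits 𝔸, ∀ a b : 𝔸, B (conjR u a) b = B a (conjR u⁻¹ b) :=
    fun u hu a b => re_trace_star_pair_invariant τ hτt hu a b
  -- direction by direction
  have hdir : ∀ μ : Fin d, ∑ᶠ x, (τ (star (A x μ) * covDerivFwd η U₀ μ g x)).re =
      ∑ᶠ x, (τ (star (covDeriv η U₀ μ (fun z => A z μ) x) * g x)).re := by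
    intro μ
    exact finsum_pair_covDerivFwd B (unitaryUnits 𝔸) η U₀ hB μ (fun x => hU x μ) (f := g) (hA μ)
  simp only [hdir]
  -- collect the directions: `Σ_μ D^{η*}_μ A_μ = D^{η*}A`
  have hsupp : ∀ μ : Fin d, (Function.support fun x => (τ (star (covDeriv η U₀ μ (fun z => A z μ) x) * g x)).re).Finite := by
    intro μ
    -- `supp (D*_μ A_μ) ⊆ supp A_μ ∪ (supp A_μ + e_μ)`
    refine (((hA μ).union ((hA μ).image fun x => x + e μ))).subset fun x hx => ?_
    rw [Function.mem_support] at hx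
    by_contra h
    simp only [Set.mem_union, Function.mem_support, Set.mem_image, not_or, not_not, not_exists, not_and] at h
    apply hx
    have h1 : A x μ = 0 := h.1
    have h2 : A (x - e μ) μ = 0 := by
      by_contra h2
      exact h.2 (x - e μ) h2 (by abel)
    simp [covDeriv, h1, h2, conjR]
  rw [← finsum_sum_comm _ _ fun μ _ => hsupp μ]
  refine finsum_congr fun x => ?_
  rw [covDivB, star_sum, Finset.sum_mul, map_sum, Complex.re_sum]

end Pairing

/-! ## §2  `⟨A, D R(U₀) D* A⟩ = ‖R(U₀)(𝟙_{Ω₀}D^{η*}_{U₀}A)‖² ≥ 0` -/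

section Square

variable {τ : 𝔸 →ₗ[ℂ] ℂ} {s : Finset (Site d)} {L m : ℕ} {η : ℝ} {Λs : ℕ → Set (Site d)} {U₀ : Site d → Fin d → 𝔸ˣ}

/-- ★★ **THE GAUGE-FIXING TERM IS A SQUARE**: for a faithful Hermitian tracial `τ` on a finite-dimensional fibre, a unitary `U₀` and a finitely supported bond
field `A`, with `f = 𝟙_{Ω₀}D^{η*}_{U₀}A ∈ L²(Ω₀, ·)` and `R = projE …` the orthogonal projection of (3.21)–(3.22):
`Σ_μ Σᶠ_x Re τ(A(x,μ)* (D^η_{U₀,μ} R(U₀) f)(x)) = ⟨Rf, Rf⟩` — i.e. `⟨A, D R D* A⟩ = ⟨D*A, R D*A⟩ = ‖R D*A‖²` (adjointness of `D`, then `R = Rᵀ = R²`).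
[cite: Balaban1985BackgroundPropagators, (3.20) p.394 («−(1/2α)‖RD*A‖²»), (3.26) p.395, (3.21)–(3.22) p.394] -/
theorem finsum_re_trace_bond_DRD_eq_formE_sq [FiniteDimensional ℝ 𝔸] (hτt : ∀ a b : 𝔸, τ (a * b) = τ (b * a))
    (hτs : ∀ a : 𝔸, τ (star a) = starRingEnd ℂ (τ a)) (hτp : ∀ a : 𝔸, a ≠ 0 → 0 < (τ (star a * a)).re)
    (hU : ∀ (x : Site d) (κ : Fin d), U₀ x κ ∈ unitaryUnits 𝔸) {A : Site d → Fin d → 𝔸}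
    (hA : ∀ μ : Fin d, (Function.support fun x => A x μ).Finite) :
    ∑ μ : Fin d, ∑ᶠ x, (τ (star (A x μ) * covDerivFwd η U₀ μ (projR τ s L m η Λs U₀ (covDivB η U₀ A)) x)).re =
      formE τ s (projE τ s L m η Λs U₀ ⟨_, indicator_mem_suppSub s (covDivB η U₀ A)⟩)
        (projE τ s L m η Λs U₀ ⟨_, indicator_mem_suppSub s (covDivB η U₀ A)⟩) := by
  set f : suppSub (𝔸 := 𝔸) s := ⟨_, indicator_mem_suppSub s (covDivB η U₀ A)⟩ with hf
  set P := projE τ s L m η Λs U₀ with hP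
  -- move `D^η` onto `A`
  rw [finsum_re_trace_bond_covDerivFwd τ η hτt hU hA]
  -- `R f` vanishes off `Ω₀`, so the `finsum` is the sum over `Ω₀`, i.e. `formE f (Rf)`
  have hRf : ∀ x, x ∉ s → ((P f : suppSub (𝔸 := 𝔸) s) : Site d → 𝔸) x = 0 := fun x hx => (P f).2 x hx
  have h1 : ∑ᶠ x, (τ (star (covDivB η U₀ A x) * projR τ s L m η Λs U₀ (covDivB η U₀ A) x)).re = formE τ s f (P f) := by
    rw [formE_apply]
    have hsupp : (Function.support fun x => (τ (star (covDivB η U₀ A x) * projR τ s L m η Λs U₀ (covDivB η U₀ A) x)).re) ⊆ ↑s := by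
      intro x hx
      rw [Function.mem_support] at hx
      by_contra hxs
      apply hx
      have : projR τ s L m η Λs U₀ (covDivB η U₀ A) x = 0 := hRf x (fun h => hxs (Finset.mem_coe.2 h))
      rw [this, mul_zero, map_zero, Complex.zero_re]
    rw [finsum_eq_sum_of_support_subset _ hsupp]
    refine Finset.sum_congr rfl fun x hx => ?_
    have hfx : (f : Site d → 𝔸) x = covDivB η U₀ A x := Set.indicator_of_mem (Finset.mem_coe.2 hx) _
    rw [hfx]
    rfl
  rw [h1]
  -- `⟨f, Rf⟩ = ⟨f, R(Rf)⟩ = ⟨Rf, Rf⟩`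
  have hidem : P (P f) = P f := by
    have h := projE_isIdempotentElem (τ := τ) (s := s) L m η Λs U₀ hτs hτp
    exact congrArg (fun T : suppSub (𝔸 := 𝔸) s →ₗ[ℝ] suppSub (𝔸 := 𝔸) s => T f) h.eq
  calc formE τ s f (P f) = formE τ s f (P (P f)) := by rw [hidem]
    _ = formE τ s (P f) (P f) := (formE_projE_symm (τ := τ) (s := s) L m η Λs U₀ hτs hτp f (P f)).symm

/-- each diagonal term `Re τ(a* a)` is non-negative for a faithful positive trace. [folklore] -/
private theorem re_trace_star_mul_self_nonneg (τ : 𝔸 →ₗ[ℂ] ℂ) (hτp : ∀ a : 𝔸, a ≠ 0 → 0 < (τ (star a * a)).re) (a : 𝔸) :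
    0 ≤ (τ (star a * a)).re := by
  by_cases ha : a = 0
  · rw [ha, mul_zero, map_zero, Complex.zero_re]
  · exact (hτp a ha).le

/-- ★★ **`⟨A, D^η_{U₀} R(U₀) D^{η*}_{U₀} A⟩ ≥ 0`** — the gauge-fixing summand of `Δ^η_a(U₀)` ((3.26)) is positive semi-definite for the constructed `R(U₀)`
at every unitary background (the exponent of (3.20) is `−(1/2α)` times a SQUARE). [cite: Balaban1985BackgroundPropagators, (3.20) p.394, (3.26) p.395, Thm 3.11 p.416] -/
theorem finsum_re_trace_bond_DRD_nonneg [FiniteDimensional ℝ 𝔸] (hτt : ∀ a b : 𝔸, τ (a * b) = τ (b * a))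
    (hτs : ∀ a : 𝔸, τ (star a) = starRingEnd ℂ (τ a)) (hτp : ∀ a : 𝔸, a ≠ 0 → 0 < (τ (star a * a)).re)
    (hU : ∀ (x : Site d) (κ : Fin d), U₀ x κ ∈ unitaryUnits 𝔸) {A : Site d → Fin d → 𝔸}
    (hA : ∀ μ : Fin d, (Function.support fun x => A x μ).Finite) :
    0 ≤ ∑ μ : Fin d, ∑ᶠ x, (τ (star (A x μ) * covDerivFwd η U₀ μ (projR τ s L m η Λs U₀ (covDivB η U₀ A)) x)).re := by
  rw [finsum_re_trace_bond_DRD_eq_formE_sq hτt hτs hτp hU hA, formE_apply]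
  exact Finset.sum_nonneg fun x _ => re_trace_star_mul_self_nonneg τ hτp _

/-- ★ **… AND IT VANISHES IFF `R(U₀)(𝟙_{Ω₀}D^{η*}_{U₀}A) = 0`** (the Landau condition in projection form; positive-definiteness of `⟨·,·⟩`).
[cite: Balaban1985BackgroundPropagators, (3.20)–(3.22) p.394; Balaban1985RegularSpaces, (1.38) p.82] -/
theorem finsum_re_trace_bond_DRD_eq_zero_iff [FiniteDimensional ℝ 𝔸] (hτt : ∀ a b : 𝔸, τ (a * b) = τ (b * a))
    (hτs : ∀ a : 𝔸, τ (star a) = starRingEnd ℂ (τ a)) (hτp : ∀ a : 𝔸, a ≠ 0 → 0 < (τ (star a * a)).re)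
    (hU : ∀ (x : Site d) (κ : Fin d), U₀ x κ ∈ unitaryUnits 𝔸) {A : Site d → Fin d → 𝔸}
    (hA : ∀ μ : Fin d, (Function.support fun x => A x μ).Finite) :
    ∑ μ : Fin d, ∑ᶠ x, (τ (star (A x μ) * covDerivFwd η U₀ μ (projR τ s L m η Λs U₀ (covDivB η U₀ A)) x)).re = 0 ↔
      projR τ s L m η Λs U₀ (covDivB η U₀ A) = 0 := by
  rw [finsum_re_trace_bond_DRD_eq_formE_sq hτt hτs hτp hU hA]
  constructor
  · intro h
    have h0 := formE_apply_self_eq_zero τ s hτp h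
    rw [projR, h0]
    rfl
  · intro h
    have h0 : projE τ s L m η Λs U₀ ⟨_, indicator_mem_suppSub s (covDivB η U₀ A)⟩ = 0 := by
      apply Subtype.ext
      exact h
    rw [h0, map_zero]

/-- **BESSEL: `⟨Rf, Rf⟩ ≤ ⟨f, f⟩`** for the orthogonal projection (`f = Rf + (f − Rf)` with `f − Rf ⊥ Rf`, both squares non-negative).
[cite: Balaban1985BackgroundPropagators, (3.21)–(3.22) p.394 («an orthogonal projection»)] -/
theorem formE_projE_self_le [FiniteDimensional ℝ 𝔸] (hτs : ∀ a : 𝔸, τ (star a) = starRingEnd ℂ (τ a))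
    (hτp : ∀ a : 𝔸, a ≠ 0 → 0 < (τ (star a * a)).re) (f : suppSub (𝔸 := 𝔸) s) :
    formE τ s (projE τ s L m η Λs U₀ f) (projE τ s L m η Λs U₀ f) ≤ formE τ s f f := by
  set P := projE τ s L m η Λs U₀ with hP
  have hidem : P (P f) = P f := by
    have h := projE_isIdempotentElem (τ := τ) (s := s) L m η Λs U₀ hτs hτp
    exact congrArg (fun T : suppSub (𝔸 := 𝔸) s →ₗ[ℝ] suppSub (𝔸 := 𝔸) s => T f) h.eq
  have hsym : ∀ g g' : suppSub (𝔸 := 𝔸) s, formE τ s (P g) g' = formE τ s g (P g') :=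
    fun g g' => formE_projE_symm (τ := τ) (s := s) L m η Λs U₀ hτs hτp g g'
  -- `⟨f, f⟩ = ⟨Pf, Pf⟩ + ⟨f − Pf, f − Pf⟩`
  have hsplit : formE τ s f f = formE τ s (P f) (P f) + formE τ s (f - P f) (f - P f) := by
    have h2 : formE τ s f (P f) = formE τ s (P f) (P f) := by
      have h := hsym f (P f)
      rw [hidem] at h
      exact h.symm
    have h1 : formE τ s (P f) f = formE τ s (P f) (P f) := by rw [hsym f f]; exact h2
    simp only [map_sub, LinearMap.sub_apply, h1, h2]
    abel
  rw [hsplit, le_add_iff_nonneg_right, formE_apply]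
  exact Finset.sum_nonneg fun x _ => re_trace_star_mul_self_nonneg τ hτp _

/-- ★ **`⟨A, D R(U₀) D* A⟩ ≤ ‖𝟙_{Ω₀}D^{η*}_{U₀}A‖²`** — the gauge-fixing term is dominated by the full divergence energy `Σ_{x∈Ω₀} Re τ(|(D^{η*}_{U₀}A)(x)|²)` (`‖R‖ ≤ 1`).
[cite: Balaban1985BackgroundPropagators, (3.20)–(3.21) p.394, (3.26) p.395] -/
theorem finsum_re_trace_bond_DRD_le_div_sq [FiniteDimensional ℝ 𝔸] (hτt : ∀ a b : 𝔸, τ (a * b) = τ (b * a))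
    (hτs : ∀ a : 𝔸, τ (star a) = starRingEnd ℂ (τ a)) (hτp : ∀ a : 𝔸, a ≠ 0 → 0 < (τ (star a * a)).re)
    (hU : ∀ (x : Site d) (κ : Fin d), U₀ x κ ∈ unitaryUnits 𝔸) {A : Site d → Fin d → 𝔸}
    (hA : ∀ μ : Fin d, (Function.support fun x => A x μ).Finite) :
    ∑ μ : Fin d, ∑ᶠ x, (τ (star (A x μ) * covDerivFwd η U₀ μ (projR τ s L m η Λs U₀ (covDivB η U₀ A)) x)).re ≤
      ∑ x ∈ s, (τ (star (covDivB η U₀ A x) * covDivB η U₀ A x)).re := by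
  rw [finsum_re_trace_bond_DRD_eq_formE_sq hτt hτs hτp hU hA]
  refine (formE_projE_self_le (τ := τ) (s := s) (L := L) (m := m) (η := η) (Λs := Λs) (U₀ := U₀) hτs hτp _).trans (le_of_eq ?_)
  rw [formE_apply]
  refine Finset.sum_congr rfl fun x hx => ?_
  have hfx : ((⟨_, indicator_mem_suppSub s (covDivB η U₀ A)⟩ : suppSub (𝔸 := 𝔸) s) : Site d → 𝔸) x = covDivB η U₀ A x :=
    Set.indicator_of_mem (Finset.mem_coe.2 hx) _
  rw [hfx]

/-- ★ **(3.22) FOR THE CONSTRUCTED PROJECTION: `Rf` MINIMISES `‖f − w‖²` OVER THE RANGE `R = Δ^η_{U₀}N_𝔤(Q′(U₀))`** («Rf = Δ^η_Uλ₀, where λ₀ is a minimum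
of the function λ ∈ N(Q′), λ → ‖f − Δ^η_Uλ‖²»): for every `w` in `rangeSub`, `⟨f − Rf, f − Rf⟩ ≤ ⟨f − w, f − w⟩` (Pythagoras: `f − w = (f − Rf) + (Rf − w)`
with `Rf − w ∈ R ⊥ f − Rf`). [cite: Balaban1985BackgroundPropagators, (3.22) p.394] -/
theorem formE_sub_projE_self_le [FiniteDimensional ℝ 𝔸] (hτs : ∀ a : 𝔸, τ (star a) = starRingEnd ℂ (τ a))
    (hτp : ∀ a : 𝔸, a ≠ 0 → 0 < (τ (star a * a)).re) (f : suppSub (𝔸 := 𝔸) s) {w : suppSub (𝔸 := 𝔸) s}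
    (hw : w ∈ B9Eq321LandauProjectionZd.rangeSub s L m η Λs U₀) :
    formE τ s (f - projE τ s L m η Λs U₀ f) (f - projE τ s L m η Λs U₀ f) ≤ formE τ s (f - w) (f - w) := by
  set P := projE τ s L m η Λs U₀ with hP
  have hsym : ∀ g g' : suppSub (𝔸 := 𝔸) s, formE τ s (P g) g' = formE τ s g (P g') :=
    fun g g' => formE_projE_symm (τ := τ) (s := s) L m η Λs U₀ hτs hτp g g'
  have hPw : P w = w := B9Eq321LandauProjectionZd.projE_apply_of_mem_range (τ := τ) (s := s) L m η Λs U₀ hτs hτp hw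
  have hidem : P (P f) = P f := by
    have h := projE_isIdempotentElem (τ := τ) (s := s) L m η Λs U₀ hτs hτp
    exact congrArg (fun T : suppSub (𝔸 := 𝔸) s →ₗ[ℝ] suppSub (𝔸 := 𝔸) s => T f) h.eq
  -- `v := Rf − w ∈ R` is orthogonal to `u := f − Rf`
  have hP0 : P (f - P f) = 0 := by rw [map_sub, hidem, sub_self]
  have horth : formE τ s (f - P f) (P f - w) = 0 := by
    have h1 : formE τ s (f - P f) (P f - w) = formE τ s (f - P f) (P (P f - w)) := by
      rw [map_sub P, hidem, hPw]
    rw [h1, ← hsym, hP0, map_zero, LinearMap.zero_apply]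
  have horth' : formE τ s (P f - w) (f - P f) = 0 := by
    rw [(B9Eq321LandauProjectionZd.formE_isSymm τ s hτs).eq, horth]
  have hsplit : formE τ s (f - w) (f - w) =
      formE τ s (f - P f) (f - P f) + formE τ s (P f - w) (P f - w) := by
    have hdec : f - w = (f - P f) + (P f - w) := by abel
    rw [hdec]
    simp only [map_add, LinearMap.add_apply, horth, horth']
    abel
  rw [hsplit, le_add_iff_nonneg_right, formE_apply]
  exact Finset.sum_nonneg fun x _ => re_trace_star_mul_self_nonneg τ hτp _

end Square

/-! ## §3  The same for the letter family `opsLandau` at a member with finite `Ω₀` -/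

section Letter

variable (τ : 𝔸 →ₗ[ℂ] ℂ) {L : ℕ}

/-- ★ **THE `DRD*` LETTER OF `opsLandau τ ops₀` IS POSITIVE SEMI-DEFINITE** at a member `(M, i, m)` with finite `Ω₀`, every unitary `U₀`, every finitely
supported bond field `A`: `Σ_μ Σᶠ_x Re τ(A(x,μ)* (DRDs U₀ A)(x,μ)) ≥ 0` — the (3.26) gauge-fixing summand for the genuine letter.
[cite: Balaban1985BackgroundPropagators, (3.26) p.395, (3.20) p.394] -/
theorem opsLandau_DRDs_form_nonneg [FiniteDimensional ℝ 𝔸] (hτt : ∀ a b : 𝔸, τ (a * b) = τ (b * a))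
    (hτs : ∀ a : 𝔸, τ (star a) = starRingEnd ℂ (τ a)) (hτp : ∀ a : 𝔸, a ≠ 0 → 0 < (τ (star a * a)).re)
    (ops₀ : ℝ → ZdIdx d L → ℕ → OpsZd d 𝔸) (M : ℝ) (i : ZdIdx d L) (m : ℕ) (hΩ : (i.Ω 0).Finite)
    {U₀ : Site d → Fin d → 𝔸ˣ} (hU : ∀ (x : Site d) (κ : Fin d), U₀ x κ ∈ unitaryUnits 𝔸) {A : Site d → Fin d → 𝔸}
    (hA : ∀ μ : Fin d, (Function.support fun x => A x μ).Finite) :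
    0 ≤ ∑ μ : Fin d, ∑ᶠ x, (τ (star (A x μ) * (opsLandau τ ops₀ M i m).DRDs U₀ A x μ)).re := by
  simp only [B9Eq321LandauProjectionZd.opsLandau_DRDs_of_finite τ ops₀ M i m hΩ]
  exact finsum_re_trace_bond_DRD_nonneg hτt hτs hτp hU hA

end Letter

/-! ## §4  The principal part `D^{η*}_{U₀}D^η_{U₀}` of (3.10) is a square at a curved background: the energy identity -/

section Principal

variable {V : Type*} [AddCommGroup V] [Module ℝ V]
variable (B : 𝔸 →ₗ[ℝ] 𝔸 →ₗ[ℝ] V) (S : Subgroup 𝔸ˣ) (η : ℝ) {U₀ : Site d → Fin d → 𝔸ˣ}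

/-- the plaquette derivative (3.4) of a componentwise finitely supported bond field has finitely supported components (it is a difference of two forward
covariant derivatives, `B8Eq146AExpansion.plaqCovDeriv_eq_covDerivFwd`). [cite: Balaban1985BackgroundPropagators, (3.4) p.391] -/
theorem support_plaqCovDeriv_finite {A : Site d → Fin d → 𝔸} (hA : ∀ μ : Fin d, (Function.support fun x => A x μ).Finite) (μ ν : Fin d) :
    (Function.support fun x => B8Eq146AExpansion.plaqCovDeriv η U₀ A μ ν x).Finite := by
  refine ((B9Eq321LandauOrthogonalZd.support_covDerivFwd_finite η U₀ μ (hA ν)).union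
    (B9Eq321LandauOrthogonalZd.support_covDerivFwd_finite η U₀ ν (hA μ))).subset fun x hx => ?_
  rw [Function.mem_support, B8Eq146AExpansion.plaqCovDeriv_eq_covDerivFwd] at hx
  by_contra h
  simp only [Set.mem_union, Function.mem_support, not_or, not_not] at h
  exact hx (by rw [h.1, h.2, sub_zero])

/-- ★★ **THE ENERGY IDENTITY AT A CURVED BACKGROUND** ([B9] (3.10) «Δ = D*D + Δ′»'s principal part; [B8] (1.55)'s current `J = D^{η*}_{U₀}D^η_{U₀}A` =
`B8Eq155JBound.Jcur`): for every real pairing `B` invariant under a subgroup `S` of units containing the bond variables of `U₀`, and every componentwise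
finitely supported bond field `A`, `Σ_κ Σᶠ_x B(A_κ(x), J_κ(x)) = Σ_κ Σ_{ν<κ} Σᶠ_x B((D^η_{U₀}A)_{νκ}(x), (D^η_{U₀}A)_{νκ}(x))` — the divergence (1.2) of the
plaquette derivative (3.4) IS the pairing `⟨D^η_{U₀}A, D^η_{U₀}A⟩` (plaquettes indexed once; the flat `U₀ = 1`, `𝔸 = ℂ` case is dag-n05-w3's
`B8FlatBondCalculusZd.sum_finsum_conj_mul_Jcur`). [cite: Balaban1985BackgroundPropagators, (3.9)–(3.10) p.392, (3.4) p.391; Balaban1985RegularSpaces, (1.2) p.76, (1.55) p.86] -/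
theorem sum_finsum_pair_Jcur (hB : ∀ u ∈ S, ∀ a b : 𝔸, B (conjR u a) b = B a (conjR u⁻¹ b)) (hU : ∀ (x : Site d) (κ : Fin d), U₀ x κ ∈ S)
    {A : Site d → Fin d → 𝔸} (hA : ∀ μ : Fin d, (Function.support fun x => A x μ).Finite) :
    ∑ κ : Fin d, ∑ᶠ x, B (A x κ) (B8Eq155JBound.Jcur η U₀ A κ x) =
      ∑ κ : Fin d, ∑ ν ∈ Finset.Iio κ, ∑ᶠ x,
        B (B8Eq146AExpansion.plaqCovDeriv η U₀ A ν κ x) (B8Eq146AExpansion.plaqCovDeriv η U₀ A ν κ x) := by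
  classical
  -- fold the plaquette derivative into a letter `F`
  set F : Fin d → Fin d → Site d → 𝔸 := fun μ ν x => B8Eq146AExpansion.plaqCovDeriv η U₀ A μ ν x with hFdef
  have hF : ∀ μ ν x, B8Eq146AExpansion.plaqCovDeriv η U₀ A μ ν x = F μ ν x := fun _ _ _ => rfl
  have hFfin : ∀ μ ν, (Function.support (F μ ν)).Finite := fun μ ν => support_plaqCovDeriv_finite η hA μ ν
  have hFexp : ∀ μ ν x, F μ ν x = covDerivFwd η U₀ μ (fun y => A y ν) x - covDerivFwd η U₀ ν (fun y => A y μ) x :=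
    fun μ ν x => B8Eq146AExpansion.plaqCovDeriv_eq_covDerivFwd η U₀ A μ ν x
  have hJ : ∀ κ x, B8Eq155JBound.Jcur η U₀ A κ x =
      ∑ ν ∈ Finset.Iio κ, covDeriv η U₀ ν (F ν κ) x - ∑ ν ∈ Finset.Ioi κ, covDeriv η U₀ ν (F κ ν) x := fun κ x => rfl
  simp_rw [hF, hJ]
  -- supports of the pairings against `A_κ`
  have hsuppA : ∀ (κ : Fin d) (G : Site d → 𝔸), (Function.support fun x => B (A x κ) (G x)).Finite := by
    intro κ G
    refine (hA κ).subset fun x hx => ?_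
    rw [Function.mem_support] at hx ⊢
    intro h0
    exact hx (by rw [h0, map_zero, LinearMap.zero_apply])
  -- Step 1: move `D^{η*}_ν` across, direction by direction
  have hstep : ∀ κ : Fin d, ∑ᶠ x, B (A x κ)
      (∑ ν ∈ Finset.Iio κ, covDeriv η U₀ ν (F ν κ) x - ∑ ν ∈ Finset.Ioi κ, covDeriv η U₀ ν (F κ ν) x) =
      ∑ ν ∈ Finset.Iio κ, ∑ᶠ x, B (covDerivFwd η U₀ ν (fun y => A y κ) x) (F ν κ x) -
      ∑ ν ∈ Finset.Ioi κ, ∑ᶠ x, B (covDerivFwd η U₀ ν (fun y => A y κ) x) (F κ ν x) := by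
    intro κ
    have h1 : ∀ x, B (A x κ) (∑ ν ∈ Finset.Iio κ, covDeriv η U₀ ν (F ν κ) x - ∑ ν ∈ Finset.Ioi κ, covDeriv η U₀ ν (F κ ν) x) =
        ∑ ν ∈ Finset.Iio κ, B (A x κ) (covDeriv η U₀ ν (F ν κ) x) - ∑ ν ∈ Finset.Ioi κ, B (A x κ) (covDeriv η U₀ ν (F κ ν) x) := by
      intro x
      rw [map_sub, map_sum, map_sum]
    rw [finsum_congr h1, finsum_sub_distrib, finsum_sum_comm _ _ fun ν _ => hsuppA κ _, finsum_sum_comm _ _ fun ν _ => hsuppA κ _]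
    · congr 1
      · refine Finset.sum_congr rfl fun ν _ => ?_
        exact (B9Eq321LandauOrthogonalZd.finsum_pair_covDerivFwd_left B S η U₀ hB ν (fun x => hU x ν) (f := fun y => A y κ)
          (hFfin ν κ)).symm
      · refine Finset.sum_congr rfl fun ν _ => ?_
        exact (B9Eq321LandauOrthogonalZd.finsum_pair_covDerivFwd_left B S η U₀ hB ν (fun x => hU x ν) (f := fun y => A y κ)
          (hFfin κ ν)).symm
    · refine (hA κ).subset fun x hx => ?_
      rw [Function.mem_support] at hx ⊢
      intro h0
      exact hx (by simp only [h0, map_zero, LinearMap.zero_apply, Finset.sum_const_zero])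
    · refine (hA κ).subset fun x hx => ?_
      rw [Function.mem_support] at hx ⊢
      intro h0
      exact hx (by simp only [h0, map_zero, LinearMap.zero_apply, Finset.sum_const_zero])
  -- Step 2: the right side expanded: `B(F_{νκ}, F_{νκ}) = B(∇_νA_κ, F_{νκ}) − B(∇_κA_ν, F_{νκ})`
  have hsq : ∀ ν κ : Fin d, ∑ᶠ x, B (F ν κ x) (F ν κ x) =
      ∑ᶠ x, B (covDerivFwd η U₀ ν (fun y => A y κ) x) (F ν κ x) - ∑ᶠ x, B (covDerivFwd η U₀ κ (fun y => A y ν) x) (F ν κ x) := by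
    intro ν κ
    have hs1 : (Function.support fun x => B (covDerivFwd η U₀ ν (fun y => A y κ) x) (F ν κ x)).Finite := by
      refine (hFfin ν κ).subset fun x hx => ?_
      rw [Function.mem_support] at hx ⊢
      intro h0; exact hx (by rw [h0, map_zero])
    have hs2 : (Function.support fun x => B (covDerivFwd η U₀ κ (fun y => A y ν) x) (F ν κ x)).Finite := by
      refine (hFfin ν κ).subset fun x hx => ?_
      rw [Function.mem_support] at hx ⊢
      intro h0; exact hx (by rw [h0, map_zero])
    rw [← finsum_sub_distrib hs1 hs2]
    refine finsum_congr fun x => ?_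
    rw [← LinearMap.sub_apply, ← map_sub, ← hFexp]
  -- Step 3: reindex the `ν > κ` block as pairs `κ' < ν'`
  have hswap : ∑ κ : Fin d, ∑ ν ∈ Finset.Ioi κ, ∑ᶠ x, B (covDerivFwd η U₀ ν (fun y => A y κ) x) (F κ ν x) =
      ∑ κ : Fin d, ∑ ν ∈ Finset.Iio κ, ∑ᶠ x, B (covDerivFwd η U₀ κ (fun y => A y ν) x) (F ν κ x) := by
    rw [Finset.sum_sigma' Finset.univ (fun κ => Finset.Ioi κ), Finset.sum_sigma' Finset.univ (fun κ => Finset.Iio κ)]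
    refine Finset.sum_bij' (fun p _ => ⟨p.2, p.1⟩) (fun p _ => ⟨p.2, p.1⟩) ?_ ?_ ?_ ?_ ?_
    · rintro ⟨κ, ν⟩ hp
      simp only [Finset.mem_sigma, Finset.mem_univ, Finset.mem_Ioi, true_and] at hp
      simp only [Finset.mem_sigma, Finset.mem_univ, Finset.mem_Iio, true_and]
      exact hp
    · rintro ⟨κ, ν⟩ hp
      simp only [Finset.mem_sigma, Finset.mem_univ, Finset.mem_Iio, true_and] at hp
      simp only [Finset.mem_sigma, Finset.mem_univ, Finset.mem_Ioi, true_and]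
      exact hp
    · rintro ⟨κ, ν⟩ _; rfl
    · rintro ⟨κ, ν⟩ _; rfl
    · rintro ⟨κ, ν⟩ _; rfl
  simp_rw [hstep, hsq]
  simp only [Finset.sum_sub_distrib]
  rw [hswap]

variable {τ : 𝔸 →ₗ[ℂ] ℂ}

/-- ★★ **`⟨A, D^{η*}_{U₀}D^η_{U₀}A⟩ = Σ_p Re τ(|(D^η_{U₀}A)(p)|²) ≥ 0` AT A UNITARY BACKGROUND** for the pairing `Re τ(a*b)` of a tracial faithful `τ`: the principal
part of the Hessian (3.10) is positive semi-definite on `ℤᵈ` — with §2, TWO of the four summands of `Δ^η_a(U₀)` ((3.26)) are squares for genuine objects.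
[cite: Balaban1985BackgroundPropagators, (3.10) p.392, (3.26) p.395, Thm 3.11 p.416; Balaban1985RegularSpaces, (1.55) p.86] -/
theorem sum_finsum_re_trace_Jcur_nonneg (hτt : ∀ a b : 𝔸, τ (a * b) = τ (b * a)) (hτp : ∀ a : 𝔸, a ≠ 0 → 0 < (τ (star a * a)).re)
    (hU : ∀ (x : Site d) (κ : Fin d), U₀ x κ ∈ unitaryUnits 𝔸) {A : Site d → Fin d → 𝔸}
    (hA : ∀ μ : Fin d, (Function.support fun x => A x μ).Finite) :
    0 ≤ ∑ κ : Fin d, ∑ᶠ x, (τ (star (A x κ) * B8Eq155JBound.Jcur η U₀ A κ x)).re := by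
  let Bτ : 𝔸 →ₗ[ℝ] 𝔸 →ₗ[ℝ] ℝ :=
    LinearMap.mk₂ ℝ (fun a b => (τ (star a * b)).re)
      (fun a₁ a₂ b => by rw [star_add, add_mul, map_add, Complex.add_re])
      (fun c a b => by
        rw [star_smul, star_trivial, smul_mul_assoc, ← Complex.coe_smul, map_smul, smul_eq_mul, smul_eq_mul, Complex.re_ofReal_mul])
      (fun a b₁ b₂ => by rw [mul_add, map_add, Complex.add_re])
      (fun c a b => by rw [mul_smul_comm, ← Complex.coe_smul, map_smul, smul_eq_mul, smul_eq_mul, Complex.re_ofReal_mul])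
  have hB : ∀ u ∈ unitaryUnits 𝔸, ∀ a b : 𝔸, Bτ (conjR u a) b = Bτ a (conjR u⁻¹ b) :=
    fun u hu a b => re_trace_star_pair_invariant τ hτt hu a b
  have key := sum_finsum_pair_Jcur Bτ (unitaryUnits 𝔸) η hB hU hA
  have key' : ∑ κ : Fin d, ∑ᶠ x, (τ (star (A x κ) * B8Eq155JBound.Jcur η U₀ A κ x)).re =
      ∑ κ : Fin d, ∑ ν ∈ Finset.Iio κ, ∑ᶠ x,
        (τ (star (B8Eq146AExpansion.plaqCovDeriv η U₀ A ν κ x) * B8Eq146AExpansion.plaqCovDeriv η U₀ A ν κ x)).re := key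
  rw [key']
  refine Finset.sum_nonneg fun κ _ => Finset.sum_nonneg fun ν _ => finsum_nonneg fun x => ?_
  exact re_trace_star_mul_self_nonneg τ hτp _

end Principal

/-! ## §5  On the gauge modes `A = D^η_{U₀}λ`, `λ ∈ N_𝔤(Q′(U₀))`, the gauge-fixing term restores the full Laplacian energy -/

section GaugeModes

variable {τ : 𝔸 →ₗ[ℂ] ℂ} {s : Finset (Site d)} {L m : ℕ} {η : ℝ} {Λs : ℕ → Set (Site d)} {U₀ : Site d → Fin d → 𝔸ˣ}

/-- `D^{η*}_{U₀}D^η_{U₀}λ = Δ^η_{U₀}λ` on the gauge mode `A = D^η_{U₀}λ` — (3.23) read through the bond field `(x, μ) ↦ (D^η_{U₀,μ}λ)(x)` (definitional for the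
tree's `covLap = covDivB ∘ covDerivFwd`). [cite: Balaban1985BackgroundPropagators, (3.23) p.394] -/
theorem covDivB_gaugeMode (lam : Site d → 𝔸) (x : Site d) :
    covDivB η U₀ (fun z μ => covDerivFwd η U₀ μ lam z) x = covLap η U₀ lam x := rfl

/-- ★★ **ON A GAUGE MODE FROM `N_𝔤(Q′(U₀))` THE GAUGE-FIXING TERM IS THE FULL LAPLACIAN ENERGY**: for `λ ∈ N_𝔤(Q′(U₀))` (Hermitian, supported in `Ω₀`,
`Q′_j(U₀)λ = 0` on the `Λ_j`) and `A = D^η_{U₀}λ`, `⟨A, D^η_{U₀}R(U₀)𝟙_{Ω₀}D^{η*}_{U₀}A⟩ = Σ_{x∈Ω₀} Re τ((Δ^η_{U₀}λ)(x)*(Δ^η_{U₀}λ)(x)) = ‖Δ^η_{U₀}λ‖²_{L²(Ω₀)}` —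
since `𝟙_{Ω₀}Δ^η_{U₀}λ` lies in the range of `R(U₀)` ((3.21): «R = Δ^η_U N(Q′)»), `R` fixes it.  The role of the `DRD*` summand of (3.26): it is
coercive exactly on the pure-gauge directions that `D*D` annihilates. [cite: Balaban1985BackgroundPropagators, (3.21) p.394, (3.26) p.395, Thm 3.11 p.416] -/
theorem gaugeMode_DRD_form_eq_laplacian_energy [FiniteDimensional ℝ 𝔸] (hτt : ∀ a b : 𝔸, τ (a * b) = τ (b * a))
    (hτs : ∀ a : 𝔸, τ (star a) = starRingEnd ℂ (τ a)) (hτp : ∀ a : 𝔸, a ≠ 0 → 0 < (τ (star a * a)).re)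
    (hU : ∀ (x : Site d) (κ : Fin d), U₀ x κ ∈ unitaryUnits 𝔸) {lam : Site d → 𝔸}
    (hlam : lam ∈ B9Eq321LandauProjectionZd.gaugeNull s L m Λs U₀) :
    ∑ μ : Fin d, ∑ᶠ x, (τ (star (covDerivFwd η U₀ μ lam x) *
        covDerivFwd η U₀ μ (projR τ s L m η Λs U₀ (covDivB η U₀ fun z μ => covDerivFwd η U₀ μ lam z)) x)).re =
      ∑ x ∈ s, (τ (star (covLap η U₀ lam x) * covLap η U₀ lam x)).re := by
  have hsupp := hlam.2.1
  -- the gauge mode is componentwise finitely supported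
  have hlamf : (Function.support lam).Finite :=
    s.finite_toSet.subset fun x hx => by by_contra h'; exact hx (hsupp x fun h => h' h)
  have hA : ∀ μ : Fin d, (Function.support fun x => covDerivFwd η U₀ μ lam x).Finite :=
    fun μ => B9Eq321LandauOrthogonalZd.support_covDerivFwd_finite η U₀ μ hlamf
  rw [finsum_re_trace_bond_DRD_eq_formE_sq (A := fun z μ => covDerivFwd η U₀ μ lam z) hτt hτs hτp hU hA]
  -- `f = 𝟙_{Ω₀}Δλ` is a generator of the range, so `R f = f`
  set f : suppSub (𝔸 := 𝔸) s := ⟨_, indicator_mem_suppSub s (covDivB η U₀ fun z μ => covDerivFwd η U₀ μ lam z)⟩ with hf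
  have hfmem : f ∈ B9Eq321LandauProjectionZd.rangeSub s L m η Λs U₀ :=
    Submodule.subset_span ⟨lam, hlam, rfl⟩
  rw [B9Eq321LandauProjectionZd.projE_apply_of_mem_range L m η Λs U₀ hτs hτp hfmem, formE_apply]
  refine Finset.sum_congr rfl fun x hx => ?_
  have hfx : (f : Site d → 𝔸) x = covLap η U₀ lam x := Set.indicator_of_mem (Finset.mem_coe.2 hx) _
  rw [hfx]

end GaugeModes

end Literature.MathematicalPhysics.QuantumFieldTheory.Balaban1983to89.B9Eq326GaugeTermSquareZd

end
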